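import Mathlib
import Summits.ValiantsHypothesis.ValiantsHypothesis.Theorems.NewtonUnitEquationsDissociatedUniformTotalsLaw
import Summits.ValiantsHypothesis.ValiantsHypothesis.Theorems.NewtonUnitEquationsDissociatedUniformTotalsLawUnion
import Summits.ValiantsHypothesis.ValiantsHypothesis.Theorems.NewtonUnitEquationsDissociatedUniformTotalsLawIntervalUnion
import Summits.ValiantsHypothesis.ValiantsHypothesis.Theorems.NewtonUnitEquationsDissociatedUniformTotalsLawIntervalUnionLog
import Summits.ValiantsHypothesis.ValiantsHypothesis.Theorems.NewtonUnitEquationsDissociatedUniformTotalsLawUnionCosets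
import Literature.Computability.AlgebraicComplexity.NewtonPolygonTauProductBounds
import HarnessLib

/-!
# Crux `NewtonUnitEquations.DissociatedUniform` (stmt-ValiantsHypothesis-5905), `n = 3` totals law of model (Q**):
# unions of `r` cyclic windows and third curves with `r` runs — the interval stratum up to `log`, ARBITRARY pairs

Corollaries of `…TotalsLawIntervalUnionLog` (`unionVert_cycInterval_le_log`: `#vert conv U_s([t,t+m)) ≤ 6q(log₂ q + 3)` for all
`a b : ℤ/q → ℝ²`):
* `unionVert_union_le` — fibre unions are subadditive in the position set (`U_s(Z ∪ Z') = U_s(Z) ∪ U_s(Z')`);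
* `unionVert_intervals_le_log` — a position set that is a union of `r` cyclic windows has `#vert conv U_s(Z) ≤ r·6q(log₂ q + 3)`
  for every class, `unionTotal ≤ r·6q²(log₂ q + 3)` (`unionTotal_intervals_le_log`);
* `unionVert_addEquiv_cycInterval_le_log` — the same for automorphic images of windows (unit-step arithmetic progressions);
* `classVert_le_of_run_levels` / `totalVert_le_of_run_levels` — if the third curve `c` takes `≤ k` values and every level set is a
  union of `≤ r` cyclic windows (e.g. `c` piecewise constant with few runs), then `V_s ≤ k·r·6q(log₂ q + 3)` POINTWISE and
  `T(a,b,c) ≤ k·r·6q²(log₂ q + 3)`, for an ARBITRARY pair `a, b` — the arbitrary-pair analogue (up to `log`) of the convexly-ordered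
  class law `…TotalsLawUnimodalClasses.totalVert_le_of_convexlyOrdered` (`2(m+J)q²`).
Honest label: the log-free interval rung, `UnionTotalsLaw C` (arbitrary position sets, where the pointwise bound is `Θ(q^{4/3})`,
`…TotalsLawUnionVertOrder`) and `TotalsLawThree C` remain OPEN and are asserted nowhere; nothing here bears on VP ≠ VNP.
[folklore]
-/

set_option linter.dupNamespace false -- `ValiantsHypothesis.ValiantsHypothesis` (summit = problem) in every name

open Finset
open scoped Pointwise

namespace Summit.ValiantsHypothesis.ValiantsHypothesis.Theorems.NewtonUnitEquationsDissociatedUniform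

namespace TotalsLaw

open Literature.Computability.AlgebraicComplexity.KPTT.PlanarMinkowski

section Subadditive

variable {G : Type*} [AddCommGroup G] [Fintype G]

/-- **Subadditivity in the position set:** `#vert conv U_s(Z ∪ Z') ≤ #vert conv U_s(Z) + #vert conv U_s(Z')`. [folklore] -/
theorem unionVert_union_le (a b : G → (Fin 2 → ℝ)) (Z Z' : Set G) (s : G) :
    unionVert a b (Z ∪ Z') s ≤ unionVert a b Z s + unionVert a b Z' s := by
  classical
  set F : Bool → Finset (Fin 2 → ℝ) := fun i =>
    if i then (unionPts_finite a b Z s).toFinset else (unionPts_finite a b Z' s).toFinset with hF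
  have hU : unionPts a b (Z ∪ Z') s = (((Finset.univ : Finset Bool).biUnion F : Finset (Fin 2 → ℝ)) : Set (Fin 2 → ℝ)) := by
    rw [unionPts_union, Finset.coe_biUnion]
    ext p
    simp only [Finset.coe_univ, Set.mem_univ, Set.iUnion_true, Set.mem_iUnion, Set.mem_union, hF]
    constructor
    · rintro (h | h)
      · exact ⟨true, by simpa using h⟩
      · exact ⟨false, by simpa using h⟩
    · rintro ⟨i, hi⟩
      cases i
      · right; simpa using hi
      · left; simpa using hi
  unfold unionVert
  rw [hU]
  refine (ncard_extremePoints_biUnion_le (Finset.univ : Finset Bool) F).trans (le_of_eq ?_)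
  rw [Fintype.sum_bool, hF]
  simp only [Bool.false_eq_true, if_false, if_true, Set.Finite.coe_toFinset]

/-- Subadditivity over a finite union of position sets. [folklore] -/
theorem unionVert_biUnion_le {ι : Type*} (a b : G → (Fin 2 → ℝ)) (R : Finset ι) (Z : ι → Set G) (s : G) :
    unionVert a b (⋃ i ∈ R, Z i) s ≤ ∑ i ∈ R, unionVert a b (Z i) s := by
  classical
  induction R using Finset.induction_on with
  | empty =>
    have h0 : unionVert a b (⋃ i ∈ (∅ : Finset ι), Z i) s = 0 := by
      unfold unionVert
      have he : unionPts a b (⋃ i ∈ (∅ : Finset ι), Z i) s = ∅ := by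
        ext p; rw [mem_unionPts]; simp
      rw [he, convexHull_empty]
      simp
    rw [h0]; exact Nat.zero_le _
  | insert i R hi ih =>
    rw [Finset.set_biUnion_insert, Finset.sum_insert hi]
    exact (unionVert_union_le a b _ _ s).trans (Nat.add_le_add_left ih _)

end Subadditive

section Cyclic
variable {q : ℕ} [NeZero q]

/-- **Unions of `r` cyclic windows:** `#vert conv U_s(⋃_{i∈R} [t_i, t_i+m_i)) ≤ |R|·6q(log₂ q + 3)` for all `a, b`, every class. -/
theorem unionVert_intervals_le_log {ι : Type*} (a b : ZMod q → (Fin 2 → ℝ)) (R : Finset ι) (t m : ι → ℕ) (s : ZMod q) :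
    unionVert a b (⋃ i ∈ R, (cycInterval q (t i) (m i) : Set (ZMod q))) s ≤ R.card * (6 * q * (Nat.log 2 q + 3)) := by
  calc _ ≤ ∑ i ∈ R, unionVert a b (cycInterval q (t i) (m i) : Set (ZMod q)) s := unionVert_biUnion_le a b R _ s
    _ ≤ ∑ _i ∈ R, 6 * q * (Nat.log 2 q + 3) := Finset.sum_le_sum fun i _ => unionVert_cycInterval_le_log a b (t i) (m i) s
    _ = R.card * (6 * q * (Nat.log 2 q + 3)) := by rw [Finset.sum_const, smul_eq_mul]

/-- … and in total over the classes: `≤ |R|·6q²(log₂ q + 3)`. -/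
theorem unionTotal_intervals_le_log {ι : Type*} (a b : ZMod q → (Fin 2 → ℝ)) (R : Finset ι) (t m : ι → ℕ) :
    unionTotal a b (⋃ i ∈ R, (cycInterval q (t i) (m i) : Set (ZMod q))) ≤ R.card * (6 * q ^ 2 * (Nat.log 2 q + 3)) := by
  unfold unionTotal
  calc _ ≤ ∑ _s : ZMod q, R.card * (6 * q * (Nat.log 2 q + 3)) :=
        Finset.sum_le_sum fun s _ => unionVert_intervals_le_log a b R t m s
    _ = R.card * (6 * q ^ 2 * (Nat.log 2 q + 3)) := by
        rw [Finset.sum_const, Finset.card_univ, ZMod.card, smul_eq_mul]; ring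

/-- **The `n = 3` law up to `log`, POINTWISE, for a third curve with few runs and an ARBITRARY pair:** if `c` takes `≤ k` values
and every level set of `c` is a union of `≤ r` cyclic windows, then `V_s ≤ k·r·6q(log₂ q + 3)` for every class `s`. -/
theorem classVert_le_of_run_levels (a b c : ZMod q → (Fin 2 → ℝ)) [DecidableEq (Fin 2 → ℝ)] {k r : ℕ}
    (hk : (Finset.univ.image c).card ≤ k)
    (hc : ∀ v, ∃ R : Finset (ℕ × ℕ), R.card ≤ r ∧ c ⁻¹' {v} = ⋃ p ∈ R, (cycInterval q p.1 p.2 : Set (ZMod q)))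
    (s : ZMod q) : classVert a b c s ≤ k * (r * (6 * q * (Nat.log 2 q + 3))) := by
  calc classVert a b c s ≤ ∑ v ∈ Finset.univ.image c, unionVert a b (c ⁻¹' {v}) s :=
        classVert_le_sum_unionVert a b c s
    _ ≤ ∑ _v ∈ Finset.univ.image c, r * (6 * q * (Nat.log 2 q + 3)) :=
        Finset.sum_le_sum fun v _ => by
          obtain ⟨R, hR, h⟩ := hc v
          rw [h]
          exact (unionVert_intervals_le_log a b R (fun p => p.1) (fun p => p.2) s).trans
            (Nat.mul_le_mul_right _ hR)
    _ ≤ k * (r * (6 * q * (Nat.log 2 q + 3))) := by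
        rw [Finset.sum_const, smul_eq_mul]
        exact Nat.mul_le_mul_right _ hk

/-- **… and in TOTAL:** `T(a,b,c) ≤ k·r·6q²(log₂ q + 3)` for `a, b` arbitrary and `c` with `≤ k` values whose level sets are unions
of `≤ r` cyclic windows. -/
theorem totalVert_le_of_run_levels (a b c : ZMod q → (Fin 2 → ℝ)) [DecidableEq (Fin 2 → ℝ)] {k r : ℕ}
    (hk : (Finset.univ.image c).card ≤ k)
    (hc : ∀ v, ∃ R : Finset (ℕ × ℕ), R.card ≤ r ∧ c ⁻¹' {v} = ⋃ p ∈ R, (cycInterval q p.1 p.2 : Set (ZMod q))) :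
    totalVert a b c ≤ k * (r * (6 * q ^ 2 * (Nat.log 2 q + 3))) := by
  unfold totalVert
  calc ∑ s, classVert a b c s ≤ ∑ _s : ZMod q, k * (r * (6 * q * (Nat.log 2 q + 3))) :=
        Finset.sum_le_sum fun s _ => classVert_le_of_run_levels a b c hk hc s
    _ = k * (r * (6 * q ^ 2 * (Nat.log 2 q + 3))) := by
        rw [Finset.sum_const, Finset.card_univ, ZMod.card, smul_eq_mul]; ring

/-- **Automorphic images of windows** (e.g. arithmetic progressions with a unit difference): `#vert conv U_s(φ[t,t+m)) ≤ 6q(log₂ q+3)`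
for every additive automorphism `φ` of `ℤ/q`, via the relabelling symmetry `…UnionCosets.unionVert_comp_addEquiv`. -/
theorem unionVert_addEquiv_cycInterval_le_log (a b : ZMod q → (Fin 2 → ℝ)) (φ : ZMod q ≃+ ZMod q) (t m : ℕ) (s : ZMod q) :
    unionVert a b (φ '' (cycInterval q t m : Set (ZMod q))) s ≤ 6 * q * (Nat.log 2 q + 3) := by
  have h := unionVert_comp_addEquiv a b φ (cycInterval q t m : Set (ZMod q)) (φ.symm s)
  rw [φ.apply_symm_apply] at h
  rw [← h]
  exact unionVert_cycInterval_le_log _ _ t m _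

end Cyclic

end TotalsLaw

end Summit.ValiantsHypothesis.ValiantsHypothesis.Theorems.NewtonUnitEquationsDissociatedUniform
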